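import Summits.AtomisticToContinuum.Crystallization.Theorems.PricedLinkCensusTruncatedCensusGapLandscapeCertDefs

/-!
# Landscape certificates for the near/far split of `TruncatedCensusGap` — soundness of the generic and floor checkers

Route `PricedLinkCensus`, crux `TruncatedCensusGap` (stmt-AtomisticToContinuum-14230), line `near-far-split`
(reshape r2 of lead c5): the landscape package N1c on the class sums `F_fcc`, `F_hcp` of `V_χ` (see
`…LandscapeCertDefs`).  This file: soundness of `famOKθ`/`checkθ` (any family, any threshold), of the floor threshold (quasi-convexity of `(√u − a₀)²` and `(√(ut) − c₀)²` in the box variables, validated square roots), of `famOKfloor`/`checkFloor`, the gluing of four sub-boxes, and the MEAN family expansion.  All `[folklore]`.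
-/

noncomputable section

namespace Summit.AtomisticToContinuum.Crystallization.Theorems.PricedLinkCensusTruncatedCensusGap.StrainedMargin

/-! ## Soundness of the generic threshold checker and of the floor checker -/

section Sound
open Real Set

/-- **Soundness of `famOKθ`.** [folklore] -/
theorem famOKθ_sound {θ : ℚ} {cls : List (ℚ × ℚ × ℚ)}
    (hcls : ∀ c ∈ cls, 0 ≤ c.1 ∧ 0 ≤ c.2.1 ∧ 0 ≤ c.2.2 ∧ 0 < c.2.1 + c.2.2) {u₁ u₂ t₁ t₂ : ℚ}
    (hok : famOKθ θ cls u₁ u₂ t₁ t₂ = true) (hu0 : 0 < u₁) (hu : u₁ ≤ u₂) (ht0 : 0 < t₁)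
    (ht : t₁ ≤ t₂) {u t : ℝ} (hu1 : (u₁ : ℝ) ≤ u) (hu2 : u ≤ u₂) (ht1 : (t₁ : ℝ) ≤ t)
    (ht2 : t ≤ t₂) : (θ : ℝ) ≤ famR cls u t := by
  refine le_trans ?_ (linesR_le_famR hcls hu0 hu ht0 ht hu1 hu2 ht1 ht2)
  set ls := boxLines cls u₁ u₂ t₁ t₂ with hls
  simp only [famOKθ, Bool.and_eq_true, decide_eq_true_eq] at hok
  rw [← hls] at hok
  obtain ⟨⟨⟨h11, h12⟩, h21⟩, h22⟩ := hok
  have c11 := castLE h11; have c12 := castLE h12; have c21 := castLE h21; have c22 := castLE h22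
  rw [cast_linesVal, linesR_eq] at c11 c12 c21 c22
  rw [linesR_eq]
  exact bilinear_ge hu1 hu2 ht1 ht2 c11 c12 c21 c22

/-- **Soundness of the bisection `checkθ`.** [folklore] -/
theorem checkθ_sound {θ : ℚ} {cls : List (ℚ × ℚ × ℚ)}
    (hcls : ∀ c ∈ cls, 0 ≤ c.1 ∧ 0 ≤ c.2.1 ∧ 0 ≤ c.2.2 ∧ 0 < c.2.1 + c.2.2) :
    ∀ (f : ℕ) {u₁ u₂ t₁ t₂ : ℚ}, checkθ θ cls f u₁ u₂ t₁ t₂ = true → 0 < u₁ → u₁ ≤ u₂ →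
    0 < t₁ → t₁ ≤ t₂ → ∀ {u t : ℝ}, (u₁ : ℝ) ≤ u → u ≤ u₂ → (t₁ : ℝ) ≤ t → t ≤ t₂ →
    (θ : ℝ) ≤ famR cls u t
  | 0, u₁, u₂, t₁, t₂, hc, hu0, hu, ht0, ht, u, t, hu1, hu2, ht1, ht2 => by
    simp only [checkθ] at hc
    exact famOKθ_sound hcls hc hu0 hu ht0 ht hu1 hu2 ht1 ht2
  | f + 1, u₁, u₂, t₁, t₂, hc, hu0, hu, ht0, ht, u, t, hu1, hu2, ht1, ht2 => by
    simp only [checkθ, Bool.or_eq_true, Bool.and_eq_true] at hc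
    rcases hc with hc | ⟨⟨⟨h1, h2⟩, h3⟩, h4⟩
    · exact famOKθ_sound hcls hc hu0 hu ht0 ht hu1 hu2 ht1 ht2
    · have hum1 : u₁ ≤ (u₁ + u₂) / 2 := by linarith
      have hum2 : (u₁ + u₂) / 2 ≤ u₂ := by linarith
      have htm1 : t₁ ≤ (t₁ + t₂) / 2 := by linarith
      have htm2 : (t₁ + t₂) / 2 ≤ t₂ := by linarith
      have hum0 : 0 < (u₁ + u₂) / 2 := by linarith
      have htm0 : 0 < (t₁ + t₂) / 2 := by linarith
      have cum : (((u₁ + u₂) / 2 : ℚ) : ℝ) = ((u₁ : ℝ) + u₂) / 2 := by push_cast; ring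
      have ctm : (((t₁ + t₂) / 2 : ℚ) : ℝ) = ((t₁ : ℝ) + t₂) / 2 := by push_cast; ring
      rcases le_total u (((u₁ : ℝ) + u₂) / 2) with hum | hum <;>
        rcases le_total t (((t₁ : ℝ) + t₂) / 2) with htm | htm
      · exact checkθ_sound hcls f h1 hu0 hum1 ht0 htm1 hu1 (by rw [cum]; exact hum) ht1 (by rw [ctm]; exact htm)
      · exact checkθ_sound hcls f h2 hu0 hum1 htm0 htm2 hu1 (by rw [cum]; exact hum) (by rw [ctm]; exact htm) ht2
      · exact checkθ_sound hcls f h3 hum0 hum2 ht0 htm1 (by rw [cum]; exact hum) hu2 ht1 (by rw [ctm]; exact htm)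
      · exact checkθ_sound hcls f h4 hum0 hum2 htm0 htm2 (by rw [cum]; exact hum) hu2 (by rw [ctm]; exact htm) ht2

/-- `MEAN` is admissible class data. [folklore] -/
theorem admissible_MEAN : ∀ c ∈ MEAN, 0 ≤ c.1 ∧ 0 ≤ c.2.1 ∧ 0 ≤ c.2.2 ∧ 0 < c.2.1 + c.2.2 := by
  intro c hc
  simp only [MEAN, List.mem_cons, List.not_mem_nil, or_false] at hc
  rcases hc with rfl | rfl | rfl | rfl | rfl | rfl | rfl | rfl | rfl | rfl <;> norm_num

/-- Expansion of the `MEAN` family. [folklore] -/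
theorem famR_MEAN (u t : ℝ) : famR MEAN u t =
    3 * gR u + 3 * gR (3 * u) + 3 * gR (4 * u) + 3 * gR (u / 3 + u * t) +
      3 * gR (4 * u / 3 + u * t) + 6 * gR (7 * u / 3 + u * t) + 3 / 2 * gR (u / 3 + 4 * (u * t)) +
      3 / 2 * gR (4 * u / 3 + 4 * (u * t)) + 1 / 2 * gR (4 * (u * t)) + 3 * gR (u + 4 * (u * t)) := by
  simp only [famR, MEAN, List.map_cons, List.map_nil, List.sum_cons, List.sum_nil]
  push_cast
  ring_nf

/-- The `MEAN` family is the mean of `FCC` and `HCP`. [folklore] -/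
theorem famR_MEAN_eq (u t : ℝ) : famR MEAN u t = (famR FCC u t + famR HCP u t) / 2 := by
  rw [famR_MEAN, famR_FCC, famR_HCP]; ring

/-! ### The floor threshold -/

/-- A square deviation on an interval is largest at an endpoint. [folklore] -/
theorem sq_sub_le_max {p q x a : ℝ} (hp : p ≤ x) (hq : x ≤ q) :
    (x - a) ^ 2 ≤ max ((p - a) ^ 2) ((q - a) ^ 2) := by
  rcases le_total x a with hxa | hxa
  · have h1 : (x - a) ^ 2 ≤ (p - a) ^ 2 := by nlinarith
    exact h1.trans (le_max_left _ _)
  · have h1 : (x - a) ^ 2 ≤ (q - a) ^ 2 := by nlinarith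
    exact h1.trans (le_max_right _ _)

/-- `(√u − a₀)² ≤ Uval u` at a rational `u ≥ 0`. [folklore] -/
theorem sq_sqrt_sub_le_Uval {u : ℚ} (hu : 0 ≤ u) :
    (√(u : ℝ) - 977 / 1000) ^ 2 ≤ ((Uval u : ℚ) : ℝ) := by
  have hs := cast_sqrtLo_le_sqrt hu
  have hsq : (√(u : ℝ)) ^ 2 = u := Real.sq_sqrt (by exact_mod_cast hu)
  unfold Uval; push_cast
  nlinarith

/-- `(√(u t) − c₀)² ≤ Cval u t` at rationals with `u t ≥ 0`. [folklore] -/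
theorem sq_sqrt_sub_le_Cval {u t : ℚ} (hut : 0 ≤ u * t) :
    (√((u : ℝ) * t) - 797 / 1000) ^ 2 ≤ ((Cval u t : ℚ) : ℝ) := by
  have hs := cast_sqrtLo_le_sqrt hut
  push_cast at hs
  have hsq : (√((u : ℝ) * t)) ^ 2 = (u : ℝ) * t := Real.sq_sqrt (by exact_mod_cast hut)
  unfold Cval; push_cast
  nlinarith

/-- **The floor threshold is a valid upper bound** of `refHi − ε + lam ((√u − a₀)² + (√(ut) − c₀)²)`
on the box (`lam ≥ 0`). [folklore] -/
theorem floor_le_thrFloor {lam ε u₁ u₂ t₁ t₂ : ℚ} (hlam : 0 ≤ lam) (hu0 : 0 < u₁) (ht0 : 0 < t₁)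
    {u t : ℝ} (hu1 : (u₁ : ℝ) ≤ u) (hu2 : u ≤ u₂) (ht1 : (t₁ : ℝ) ≤ t) (ht2 : t ≤ t₂) :
    (refHi : ℝ) - ε + lam * ((√u - 977 / 1000) ^ 2 + (√(u * t) - 797 / 1000) ^ 2) ≤
      ((thrFloor lam ε u₁ u₂ t₁ t₂ : ℚ) : ℝ) := by
  have hu0R : (0 : ℝ) < u₁ := by exact_mod_cast hu0
  have ht0R : (0 : ℝ) < t₁ := by exact_mod_cast ht0
  have hu12 : u₁ ≤ u₂ := by exact_mod_cast hu1.trans hu2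
  have ht12 : t₁ ≤ t₂ := by exact_mod_cast ht1.trans ht2
  -- `√u ∈ [√u₁, √u₂]`
  have hsu1 : √(u₁ : ℝ) ≤ √u := Real.sqrt_le_sqrt hu1
  have hsu2 : √u ≤ √(u₂ : ℝ) := Real.sqrt_le_sqrt hu2
  have hA := sq_sub_le_max (a := (977 / 1000 : ℝ)) hsu1 hsu2
  have hA' : max ((√(u₁ : ℝ) - 977 / 1000) ^ 2) ((√(u₂ : ℝ) - 977 / 1000) ^ 2) ≤
      ((max (Uval u₁) (Uval u₂) : ℚ) : ℝ) := by
    push_cast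
    exact max_le_max (sq_sqrt_sub_le_Uval hu0.le) (sq_sqrt_sub_le_Uval (hu0.le.trans hu12))
  -- `u t ∈ [u₁ t₁, u₂ t₂]`
  have hut1 : ((u₁ : ℝ) * t₁) ≤ u * t := mul_le_mul hu1 ht1 ht0R.le (hu0R.le.trans hu1)
  have hut2 : u * t ≤ (u₂ : ℝ) * t₂ :=
    mul_le_mul hu2 ht2 (ht0R.le.trans ht1) (by exact_mod_cast (hu0.le.trans hu12))
  have hsv1 : √((u₁ : ℝ) * t₁) ≤ √(u * t) := Real.sqrt_le_sqrt hut1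
  have hsv2 : √(u * t) ≤ √((u₂ : ℝ) * t₂) := Real.sqrt_le_sqrt hut2
  have hB := sq_sub_le_max (a := (797 / 1000 : ℝ)) hsv1 hsv2
  have hB' : max ((√((u₁ : ℝ) * t₁) - 797 / 1000) ^ 2) ((√((u₂ : ℝ) * t₂) - 797 / 1000) ^ 2) ≤
      ((max (Cval u₁ t₁) (Cval u₂ t₂) : ℚ) : ℝ) := by
    push_cast
    exact max_le_max (sq_sqrt_sub_le_Cval (mul_nonneg hu0.le ht0.le))
      (sq_sqrt_sub_le_Cval (mul_nonneg (hu0.le.trans hu12) (ht0.le.trans ht12)))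
  have hlamR : (0 : ℝ) ≤ lam := by exact_mod_cast hlam
  unfold thrFloor; push_cast
  push_cast at hA' hB'
  nlinarith [mul_le_mul_of_nonneg_left (add_le_add (hA.trans hA') (hB.trans hB')) hlamR]

/-- **Soundness of `famOKfloor`.** [folklore] -/
theorem famOKfloor_sound {lam ε : ℚ} {cls : List (ℚ × ℚ × ℚ)} (hlam : 0 ≤ lam)
    (hcls : ∀ c ∈ cls, 0 ≤ c.1 ∧ 0 ≤ c.2.1 ∧ 0 ≤ c.2.2 ∧ 0 < c.2.1 + c.2.2) {u₁ u₂ t₁ t₂ : ℚ}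
    (hok : famOKfloor lam ε cls u₁ u₂ t₁ t₂ = true) (hu0 : 0 < u₁) (hu : u₁ ≤ u₂) (ht0 : 0 < t₁)
    (ht : t₁ ≤ t₂) {u t : ℝ} (hu1 : (u₁ : ℝ) ≤ u) (hu2 : u ≤ u₂) (ht1 : (t₁ : ℝ) ≤ t)
    (ht2 : t ≤ t₂) :
    (refHi : ℝ) - ε + lam * ((√u - 977 / 1000) ^ 2 + (√(u * t) - 797 / 1000) ^ 2) ≤ famR cls u t :=
  (floor_le_thrFloor hlam hu0 ht0 hu1 hu2 ht1 ht2).trans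
    (famOKθ_sound hcls hok hu0 hu ht0 ht hu1 hu2 ht1 ht2)

/-- **Soundness of the bisection `checkFloor`.** [folklore] -/
theorem checkFloor_sound {lam ε : ℚ} {cls : List (ℚ × ℚ × ℚ)} (hlam : 0 ≤ lam)
    (hcls : ∀ c ∈ cls, 0 ≤ c.1 ∧ 0 ≤ c.2.1 ∧ 0 ≤ c.2.2 ∧ 0 < c.2.1 + c.2.2) :
    ∀ (f : ℕ) {u₁ u₂ t₁ t₂ : ℚ}, checkFloor lam ε cls f u₁ u₂ t₁ t₂ = true → 0 < u₁ → u₁ ≤ u₂ →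
    0 < t₁ → t₁ ≤ t₂ → ∀ {u t : ℝ}, (u₁ : ℝ) ≤ u → u ≤ u₂ → (t₁ : ℝ) ≤ t → t ≤ t₂ →
    (refHi : ℝ) - ε + lam * ((√u - 977 / 1000) ^ 2 + (√(u * t) - 797 / 1000) ^ 2) ≤ famR cls u t
  | 0, u₁, u₂, t₁, t₂, hc, hu0, hu, ht0, ht, u, t, hu1, hu2, ht1, ht2 => by
    simp only [checkFloor] at hc
    exact famOKfloor_sound hlam hcls hc hu0 hu ht0 ht hu1 hu2 ht1 ht2
  | f + 1, u₁, u₂, t₁, t₂, hc, hu0, hu, ht0, ht, u, t, hu1, hu2, ht1, ht2 => by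
    simp only [checkFloor, Bool.or_eq_true, Bool.and_eq_true] at hc
    rcases hc with hc | ⟨⟨⟨h1, h2⟩, h3⟩, h4⟩
    · exact famOKfloor_sound hlam hcls hc hu0 hu ht0 ht hu1 hu2 ht1 ht2
    · have hum1 : u₁ ≤ (u₁ + u₂) / 2 := by linarith
      have hum2 : (u₁ + u₂) / 2 ≤ u₂ := by linarith
      have htm1 : t₁ ≤ (t₁ + t₂) / 2 := by linarith
      have htm2 : (t₁ + t₂) / 2 ≤ t₂ := by linarith
      have hum0 : 0 < (u₁ + u₂) / 2 := by linarith
      have htm0 : 0 < (t₁ + t₂) / 2 := by linarith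
      have cum : (((u₁ + u₂) / 2 : ℚ) : ℝ) = ((u₁ : ℝ) + u₂) / 2 := by push_cast; ring
      have ctm : (((t₁ + t₂) / 2 : ℚ) : ℝ) = ((t₁ : ℝ) + t₂) / 2 := by push_cast; ring
      rcases le_total u (((u₁ : ℝ) + u₂) / 2) with hum | hum <;>
        rcases le_total t (((t₁ : ℝ) + t₂) / 2) with htm | htm
      · exact checkFloor_sound hlam hcls f h1 hu0 hum1 ht0 htm1 hu1 (by rw [cum]; exact hum) ht1 (by rw [ctm]; exact htm)
      · exact checkFloor_sound hlam hcls f h2 hu0 hum1 htm0 htm2 hu1 (by rw [cum]; exact hum) (by rw [ctm]; exact htm) ht2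
      · exact checkFloor_sound hlam hcls f h3 hum0 hum2 ht0 htm1 (by rw [cum]; exact hum) hu2 ht1 (by rw [ctm]; exact htm)
      · exact checkFloor_sound hlam hcls f h4 hum0 hum2 htm0 htm2 (by rw [cum]; exact hum) hu2 (by rw [ctm]; exact htm) ht2

/-- Gluing four sub-boxes with a common interior point `(um, tm)`. [folklore] -/
theorem box_union4 {P : ℝ → ℝ → Prop} {u₁ um u₂ t₁ tm t₂ : ℝ}
    (h1 : ∀ u t, u₁ ≤ u → u ≤ um → t₁ ≤ t → t ≤ tm → P u t)
    (h2 : ∀ u t, u₁ ≤ u → u ≤ um → tm ≤ t → t ≤ t₂ → P u t)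
    (h3 : ∀ u t, um ≤ u → u ≤ u₂ → t₁ ≤ t → t ≤ tm → P u t)
    (h4 : ∀ u t, um ≤ u → u ≤ u₂ → tm ≤ t → t ≤ t₂ → P u t) :
    ∀ u t, u₁ ≤ u → u ≤ u₂ → t₁ ≤ t → t ≤ t₂ → P u t := by
  intro u t hu1 hu2 ht1 ht2
  rcases le_total u um with hum | hum <;> rcases le_total t tm with htm | htm
  · exact h1 u t hu1 hum ht1 htm
  · exact h2 u t hu1 hum htm ht2
  · exact h3 u t hum hu2 ht1 htm
  · exact h4 u t hum hu2 htm ht2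

end Sound

/-- **Registered sub-goal `landscapeMean_eq`** (summary): the MEAN family is the mean of the `FCC` and `HCP`
families of `…StrainedMarginCertDefs`. [folklore] -/
theorem landscapeMean_eq : ∀ u t : ℝ, famR MEAN u t = (famR FCC u t + famR HCP u t) / 2 := famR_MEAN_eq


end Summit.AtomisticToContinuum.Crystallization.Theorems.PricedLinkCensusTruncatedCensusGap.StrainedMargin
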